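import Summits.CriticalPhenomena.PercolationContinuityZ3.Theorems.PercNearOneGluingNoHeavyQuantLightLightTwoBlobDEC
import Summits.CriticalPhenomena.PercolationContinuityZ3.Theorems.PercNearOneGluingNoHeavyQuantLightTwoBlobDEC
import Summits.CriticalPhenomena.PercolationContinuityZ3.Theorems.PercNearOneGluingNoHeavyQuantConvHeavy
import HarnessLib

/-!
# QUANT lane R8, T-DEC: **DEC at explicit targets is closed under slicing (by ANY blob) and under convolution in the NO-GIANT regime**
# (layers at or above the top) — the assembly of BLOB-DEC(2), `LightTwoBlobDEC` and `LightLightTwoBlobDEC`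

builds on p205010 (kernel theorem, internal audit signed; external expert review pending)

Support file (`--supports stmt-CriticalPhenomena-4575`), QUANT lane typer seat prim-quant-stmt (gen 23), rung R8 of
`run/shared/lean/prim/quant/LADDER.md`.  Theorems only, standard axioms, no sorries.

NO GIANTS: a `LawDec.DECAtT x T j M μ` datum with `M ≤ j` has only self-sufficient points (`2k ≥ T`) and credit pairs (`lo < hi ≤ M`,
`2lo + (hi − lo)κ_x(g) ≥ T`, heavy or light); it is the same at every layer `j ≥ M` (`decAtT_layer_noGiant`).  In this regime:
* **`LawDec.slice_light_decAtT_noGiant`** — slicing by a LIGHT blob `(a, γ′)`, `x² < γ′ < x`: `DECAtT x T j M μ`, `M ≤ j`, `M + a ≤ j′`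
  ⟹ `DECAtT x (T + a·κ_x(γ′)) j′ (M + a) (slice μ a γ′)` (lead g21's "SL-light", LEAD-NOTES-G21 N45 (6)(b), in the no-giant world).  Pieces:
  a point `k` becomes the light pair `{k, k+a; γ′}` (credit `2k + aκ′`); a heavy pair becomes `LAW2` light–heavy (`lightTwoBlobDEC_holds`,
  p300067, after `law2_swap`); a light pair with `g > x²` becomes `LAW2` light–light (`lightLightTwoBlobDEC_holds`); a light pair with `g ≤ x²`
  has `T ≤ 2lo` and is two self-sufficient points; shifts by `decAtT_shift_two`.
* **`LawDec.slice_heavy_decAtT_noGiant`** — slicing by a HEAVY blob (`x ≤ g ≤ 1`): `DECAtT x (T + a·g) …` (every no-giant datum is a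
  `BDECAtT` datum; `slice_decAtT_of_bdecAtT'`).
* **`LawDec.lconv_decAtT_noGiant`** — CONVOLUTION: `DECAtT x T₁ j₁ M₁ μ₁` (`M₁ ≤ j₁`), `DECAtT x T₂ j₂ M₂ μ₂` (`M₂ ≤ j₂`), `M₁ + M₂ ≤ j′`
  ⟹ `DECAtT x (T₁ + T₂) j′ (M₁ + M₂) (lconv M₁ M₂ μ₁ μ₂)` — term-wise over `μ₂`'s datum (`lconv_TP`, `shift_slice` of `…QuantConvHeavy`).
So every law built from relays and blobs by sums has, at layers above its top, a DEC datum at the SUM OF THE ARCH CREDITS — the target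
census-2's architecture assigns (ARCH-TREES-G49 §2).  What T-DEC still needs is the regime WITH giants (layers below the top): Conjecture SL's
light straddlers (`LawDec.SliceClosed`), the gate/conv interaction, `LawDec.SDECConvClosed` / `TreeBuiltDEC`, `Quant.TreeDEC`, `Quant.FarTreeRow` — OPEN.

[this work]; DEC rules ARCH-TREES-G49 §2.2 / DEC-TAMP-G50 §3.1 (this lane).  The gluing rows served [cite: KozmaNitzan2024, Conjecture 3 (p. 15)];
product measure [cite: Grimmett1999, §1.3 p. 10].
-/

noncomputable section

namespace Summit.CriticalPhenomena.PercolationContinuityZ3.Theorems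

namespace Quant

open Finset

/-- the two-point law `{lo, hi; g}` (as in `…QuantLawDEC`) -/
local notation3 "TP[" lo ", " hi ", " g ", " h "]" =>
  (g : ℝ) * (if (h : ℕ) = (hi : ℕ) then (1 : ℝ) else 0) + (1 - (g : ℝ)) * (if (h : ℕ) = (lo : ℕ) then (1 : ℝ) else 0)

/-- the two-blob law `(1−u)(1−v)δ₀ + u(1−v)δ_a + (1−u)vδ_b + uvδ_{a+b}` evaluated at `h` (as in `…QuantBlobDecTwoLawParts`) -/
local notation3 "LAW2[" a ", " u ", " b ", " v ", " h "]" =>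
  (1 - (u : ℝ)) * (1 - (v : ℝ)) * (if (h : ℕ) = 0 then (1 : ℝ) else 0)
    + (u : ℝ) * (1 - (v : ℝ)) * (if (h : ℕ) = (a : ℕ) then (1 : ℝ) else 0)
    + (1 - (u : ℝ)) * (v : ℝ) * (if (h : ℕ) = (b : ℕ) then (1 : ℝ) else 0)
    + (u : ℝ) * (v : ℝ) * (if (h : ℕ) = (a : ℕ) + (b : ℕ) then (1 : ℝ) else 0)

/-- the law `μ` shifted up by `s` (as in `…QuantConvHeavy`) -/
local notation3 "SH[" μ ", " s ", " h "]" => (if (s : ℕ) ≤ (h : ℕ) then (μ : ℕ → ℝ) ((h : ℕ) - (s : ℕ)) else (0 : ℝ))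

namespace LawDec

/-! ### No giants: the layer is irrelevant above the top -/

/-- **above the top the layer is irrelevant**: `M ≤ j`, `M ≤ j′`, `DECAtT x T j M μ` ⟹ `DECAtT x T j′ M μ` (same datum: no component is a
giant or a point above the layer). [this work] -/
theorem decAtT_layer_noGiant {x T : ℝ} {j j' M : ℕ} {μ : ℕ → ℝ} (hj : M ≤ j) (hj' : M ≤ j') (h : DECAtT x T j M μ) :
    DECAtT x T j' M μ := by
  obtain ⟨ρ, hρ, lam, g, lo, hi, h0, h1, hg, hlohi, hhi, hμ, hval⟩ := h
  refine ⟨ρ, hρ, lam, g, lo, hi, h0, h1, hg, hlohi, hhi, hμ, fun r hr => ?_⟩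
  rcases hval r hr with ⟨heq, hS⟩ | ⟨_, hgi, _⟩ | ⟨hlt, _, hcr⟩
  · refine Or.inl ⟨heq, Or.inl ?_⟩
    rcases hS with h2 | h2
    · exact h2
    · exfalso; have := (hlohi r).trans (hhi r); omega
  · exfalso; have := hhi r; omega
  · exact Or.inr (Or.inr ⟨hlt, (hhi r).trans hj', hcr⟩)

/-! ### Slicing by a light blob -/

/-- **a self-sufficient point sliced by a light blob**: `2k ≥ T`, `k ≤ M`, `M + a ≤ j′`, `x² < γ′ < x`, `1 ≤ a` ⟹ the pair `{k, k+a; γ′}`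
(= `slice δ_k a γ′`) is DEC(j′) at `T + a·κ_x(γ′)`. [this work] -/
theorem slice_point_light_decAtT (x T γ' γ₀ : ℝ) (j' M k a : ℕ) (hx1 : x < 1) (hγ0 : x ^ 2 < γ') (hγx : γ' < x) (ha : 1 ≤ a)
    (hkM : k ≤ M) (hj' : M + a ≤ j') (hS : T ≤ 2 * (k : ℝ)) :
    DECAtT x (T + (a : ℝ) * ((γ' - x ^ 2) / (1 - x))) j' (M + a) (slice (fun t => TP[k, k, γ₀, t]) a γ') := by
  have e : slice (fun t => TP[k, k, γ₀, t]) a γ' = fun h => TP[k, k + a, γ', h] := by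
    funext h
    simp only [slice]
    by_cases hak : a ≤ h
    · rw [if_pos hak]
      have e1 : (h - a = k) ↔ (h = k + a) := by omega
      simp only [e1]; ring
    · rw [if_neg hak, if_neg (by omega : ¬ h = k + a)]; ring
  rw [e]
  have hκ : 0 ≤ (γ' - x ^ 2) / (1 - x) := div_nonneg (by linarith) (by linarith)
  have hval : ValidAt x (T + (a : ℝ) * ((γ' - x ^ 2) / (1 - x))) j' k (k + a) γ' := by
    refine Or.inr (Or.inr ⟨Nat.lt_add_of_pos_right (by omega), by omega, ?_⟩)
    rw [if_neg (not_le.2 hγx)]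
    push_cast
    nlinarith
  exact ⟨Unit, inferInstance, fun _ => 1, fun _ => γ', fun _ => k, fun _ => k + a, fun _ => zero_le_one, by simp,
    fun _ => ⟨by nlinarith, by linarith⟩, fun _ => Nat.le_add_right k a, fun _ => Nat.add_le_add_right hkM a, fun h => by simp,
    fun _ _ => hval⟩

/-- **a pair sliced by a blob, as a shifted two-blob law**: `slice {lo, lo+b; g} a γ′ = shift_lo LAW2[b, g; a, γ′]`. [this work] -/
theorem slice_pair_eq_shift_law2 (lo b a : ℕ) (g γ' : ℝ) :
    slice (fun t => TP[lo, lo + b, g, t]) a γ' = fun h => if lo ≤ h then LAW2[b, g, a, γ', h - lo] else 0 := by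
  funext h
  rw [slice_TP]
  by_cases hlo : lo ≤ h
  · rw [if_pos hlo]
    have e0 : (h - lo = 0) ↔ (h = lo) := by omega
    have e1 : (h - lo = b) ↔ (h = lo + b) := by omega
    have e2 : (h - lo = a) ↔ (h = lo + a) := by omega
    have e3 : (h - lo = b + a) ↔ (h = lo + b + a) := by omega
    simp only [e0, e1, e2, e3]
    ring
  · rw [if_neg hlo, if_neg (by omega), if_neg (by omega), if_neg (by omega), if_neg (by omega)]
    ring

/-- **SLICING BY A LIGHT BLOB IN THE NO-GIANT REGIME ("SL-light").**  `0 < x < 1`, `x² < γ′ < x`, `1 ≤ a`, a no-giant datum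
`DECAtT x T j M μ` (`M ≤ j`), and a layer `j′ ≥ M + a` ⟹ `DECAtT x (T + a·κ_x(γ′)) j′ (M + a) (slice μ a γ′)`. [this work] -/
theorem slice_light_decAtT_noGiant (x T γ' : ℝ) (j j' M a : ℕ) (μ : ℕ → ℝ) (hx0 : 0 < x) (hx1 : x < 1) (hγ0 : x ^ 2 < γ')
    (hγx : γ' < x) (ha : 1 ≤ a) (hjM : M ≤ j) (hj' : M + a ≤ j') (h : DECAtT x T j M μ) :
    DECAtT x (T + (a : ℝ) * ((γ' - x ^ 2) / (1 - x))) j' (M + a) (slice μ a γ') := by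
  classical
  obtain ⟨ρ, hρ, lam, gg, lo, hi, h0, h1, hgg, hlohi, hhi, hμ, hval⟩ := h
  have hκ'0 : 0 ≤ (γ' - x ^ 2) / (1 - x) := div_nonneg (by linarith) (by linarith)
  have hmix : ∀ t, slice μ a γ' t = ∑ r, lam r * slice (fun s => TP[lo r, hi r, gg r, s]) a γ' t := by
    intro t
    simp only [slice]
    rw [hμ t]
    have e2 : (if a ≤ t then μ (t - a) else 0) = ∑ r, lam r * (if a ≤ t then TP[lo r, hi r, gg r, t - a] else 0) := by
      split_ifs with hat
      · rw [hμ (t - a)]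
      · simp
    rw [e2, Finset.mul_sum, Finset.mul_sum, ← Finset.sum_add_distrib]
    refine Finset.sum_congr rfl fun r _ => ?_
    ring
  refine decAtT_finite_mixture x _ j' (M + a) (slice μ a γ') lam (fun r => slice (fun s => TP[lo r, hi r, gg r, s]) a γ')
    h0 h1 hmix fun r hr => ?_
  rcases hval r hr with ⟨heq, hS⟩ | ⟨_, hgi, _⟩ | ⟨hlt, _, hcr⟩
  · -- a self-sufficient point
    have hS' : T ≤ 2 * (lo r : ℝ) := by
      rcases hS with h2 | h2
      · exact h2
      · exfalso; have := (hlohi r).trans (hhi r); omega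
    rw [← heq]
    exact slice_point_light_decAtT x T γ' (gg r) j' M (lo r) a hx1 hγ0 hγx ha ((hlohi r).trans (hhi r)) hj' hS'
  · exfalso; have := hhi r; omega
  · -- a credit pair {lo, hi; g}
    obtain ⟨b, hb⟩ : ∃ b, hi r = lo r + b := ⟨hi r - lo r, by omega⟩
    have hb1 : 1 ≤ b := by omega
    have hbr : ((hi r : ℝ) - lo r) = b := by rw [hb]; push_cast; ring
    rw [hbr] at hcr
    have hhiM : lo r + b ≤ M := by rw [← hb]; exact hhi r
    have hloM : lo r + b + a ≤ j' := by omega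
    rw [hb, slice_pair_eq_shift_law2]
    by_cases hxg : x ≤ gg r
    · -- heavy pair: light–heavy two-blob law (blobs exchanged), then shift by lo
      rw [if_pos hxg] at hcr
      have hL := lightTwoBlobDEC_holds x γ' (gg r) b a (j' - lo r) hx0 hx1 hγ0 hγx hxg (hgg r).2 hb1 ha (by omega)
      rw [law2_swap b a γ' (gg r), Nat.add_comm a b] at hL
      have hsh := decAtT_shift_two x _ (j' - lo r) (b + a) (lo r) _ hL
      rw [show j' - lo r + lo r = j' by omega] at hsh
      refine decAtT_antitone_target ?_ (decAtT_mono_top hsh (by omega))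
      nlinarith
    · -- light pair
      push Not at hxg
      rw [if_neg (not_le.2 hxg)] at hcr
      by_cases hg2 : x ^ 2 < gg r
      · -- light–light two-blob law, then shift by lo
        have hL := lightLightTwoBlobDEC_holds x (gg r) γ' a b (j' - lo r) hx0 hx1 hg2 hxg hγ0 hγx ha hb1 (by omega)
        have hsh := decAtT_shift_two x _ (j' - lo r) (b + a) (lo r) _ hL
        rw [show j' - lo r + lo r = j' by omega] at hsh
        refine decAtT_antitone_target ?_ (decAtT_mono_top hsh (by omega))
        nlinarith
      · -- gate below x²: no credit, so `lo` (hence `hi`) is self-sufficient: two point slices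
        push Not at hg2
        have hκle : (gg r - x ^ 2) / (1 - x) ≤ 0 := div_nonpos_of_nonpos_of_nonneg (by linarith) (by linarith)
        have hlo2 : T ≤ 2 * (lo r : ℝ) := by nlinarith [(Nat.cast_nonneg b : (0:ℝ) ≤ b)]
        have hhi2 : T ≤ 2 * ((lo r + b : ℕ) : ℝ) := by push_cast; linarith [(Nat.cast_nonneg b : (0:ℝ) ≤ b)]
        rw [← slice_pair_eq_shift_law2]
        have h₁ := slice_point_light_decAtT x T γ' (gg r) j' M (lo r) a hx1 hγ0 hγx ha ((hlohi r).trans (hhi r)) hj' hlo2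
        have h₂ := slice_point_light_decAtT x T γ' (gg r) j' M (lo r + b) a hx1 hγ0 hγx ha (by rw [← hb]; exact hhi r) hj' hhi2
        have hm := decAtT_mixture (1 - gg r) (by linarith [(hgg r).2]) (by linarith [(hgg r).1]) h₁ h₂
        have e : slice (fun t => TP[lo r, lo r + b, gg r, t]) a γ'
            = fun h => (1 - gg r) * slice (fun t => TP[lo r, lo r, gg r, t]) a γ' h
              + (1 - (1 - gg r)) * slice (fun t => TP[lo r + b, lo r + b, gg r, t]) a γ' h := by
          funext h
          simp only [slice_TP]
          ring
        rw [e]; exact hm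

/-! ### Slicing by a heavy blob -/

/-- a no-giant datum has no light straddler (for any blob size `a` with `M + a ≤ j′`): it is a `BDECAtT` datum at layer `j′`. [this work] -/
theorem bdecAtT_of_decAtT_noGiant {x T : ℝ} {j j' M a : ℕ} {μ : ℕ → ℝ} (hx1 : x < 1) (hjM : M ≤ j) (hj' : M + a ≤ j')
    (h : DECAtT x T j M μ) : BDECAtT x T j' M a μ := by
  obtain ⟨ρ, hρ, lam, g, lo, hi, h0, h1, hg, hlohi, hhi, hμ, hval⟩ := h
  refine ⟨ρ, hρ, lam, g, lo, hi, h0, h1, hg, hlohi, hhi, hμ, fun r hr => ?_⟩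
  rcases hval r hr with ⟨heq, hS⟩ | ⟨_, hgi, _⟩ | ⟨hlt, _, hcr⟩
  · refine Or.inl (Or.inl ⟨heq, Or.inl ?_⟩)
    rcases hS with h2 | h2
    · exact h2
    · exfalso; have := (hlohi r).trans (hhi r); omega
  · exfalso; have := hhi r; omega
  · by_cases hxg : x ≤ g r
    · rw [if_pos hxg] at hcr
      exact Or.inl (Or.inr (Or.inr ⟨hlt, (hhi r).trans (by omega), hxg, hcr⟩))
    · rw [if_neg hxg] at hcr
      push Not at hxg
      by_cases hg2 : x ^ 2 < g r
      · exact Or.inr (Or.inr ⟨hlt, by have := hhi r; omega, hg2, hxg, hcr⟩)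
      · push Not at hg2
        have hκle : (g r - x ^ 2) / (1 - x) ≤ 0 := div_nonpos_of_nonpos_of_nonneg (by linarith) (by linarith)
        have hd : (0 : ℝ) ≤ (hi r : ℝ) - lo r := by
          have : (lo r : ℝ) ≤ hi r := by exact_mod_cast hlt.le
          linarith
        refine Or.inr (Or.inl ⟨hlt, Or.inl ?_⟩)
        nlinarith [mul_nonneg hd (neg_nonneg.2 hκle)]

/-- **SLICING BY A HEAVY BLOB IN THE NO-GIANT REGIME**: `0 < x < 1`, `x ≤ g ≤ 1`, `1 ≤ a`, `DECAtT x T j M μ` (`M ≤ j`), `M + a ≤ j′`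
⟹ `DECAtT x (T + a·g) j′ (M + a) (slice μ a g)` (`slice_decAtT_of_bdecAtT'`). [this work] -/
theorem slice_heavy_decAtT_noGiant (x T g : ℝ) (j j' M a : ℕ) (μ : ℕ → ℝ) (hx0 : 0 < x) (hx1 : x < 1) (hxg : x ≤ g) (hg1 : g ≤ 1)
    (ha : 1 ≤ a) (hjM : M ≤ j) (hj' : M + a ≤ j') (h : DECAtT x T j M μ) :
    DECAtT x (T + (a : ℝ) * g) j' (M + a) (slice μ a g) :=
  slice_decAtT_of_bdecAtT' x T g j' M a μ hx0 hx1 hxg hg1 ha (bdecAtT_of_decAtT_noGiant hx1 hjM hj' h)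

/-! ### Convolution -/

/-- **CONVOLUTION CLOSURE OF DEC IN THE NO-GIANT REGIME.**  `0 < x < 1`; `μ₁ ≥ 0` on `{0..M₁}` with a no-giant datum
`DECAtT x T₁ j₁ M₁ μ₁` (`M₁ ≤ j₁`); `μ₂` with a no-giant datum `DECAtT x T₂ j₂ M₂ μ₂` (`M₂ ≤ j₂`); `M₁ + M₂ ≤ j′` ⟹
`DECAtT x (T₁ + T₂) j′ (M₁ + M₂) (lconv M₁ M₂ μ₁ μ₂)`. [this work] -/
theorem lconv_decAtT_noGiant (x T₁ T₂ : ℝ) (j₁ j₂ j' M₁ M₂ : ℕ) (μ₁ μ₂ : ℕ → ℝ) (hx0 : 0 < x) (hx1 : x < 1)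
    (h1M : ∀ h, M₁ < h → μ₁ h = 0) (hj₁ : M₁ ≤ j₁) (hj₂ : M₂ ≤ j₂) (hj' : M₁ + M₂ ≤ j')
    (hμ₁ : DECAtT x T₁ j₁ M₁ μ₁) (hμ₂ : DECAtT x T₂ j₂ M₂ μ₂) :
    DECAtT x (T₁ + T₂) j' (M₁ + M₂) (lconv M₁ M₂ μ₁ μ₂) := by
  classical
  obtain ⟨ρ, hρ, lam, gg, lo, hi, h0, h1, hgg, hlohi, hhi, hμ, hval⟩ := hμ₂
  have hmix : ∀ t, lconv M₁ M₂ μ₁ μ₂ t = ∑ r, lam r * lconv M₁ M₂ μ₁ (fun k => TP[lo r, hi r, gg r, k]) t := by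
    intro t
    rw [← lconv_sum_right]
    simp only [lconv]
    refine Finset.sum_congr rfl fun i _ => Finset.sum_congr rfl fun k _ => ?_
    rw [hμ k]
  refine decAtT_finite_mixture x _ j' (M₁ + M₂) _ lam (fun r => lconv M₁ M₂ μ₁ (fun k => TP[lo r, hi r, gg r, k]))
    h0 h1 hmix fun r hr => ?_
  have e : lconv M₁ M₂ μ₁ (fun k => TP[lo r, hi r, gg r, k]) = fun h => (1 - gg r) * SH[μ₁, lo r, h] + gg r * SH[μ₁, hi r, h] := by
    funext h; exact lconv_TP M₁ M₂ (lo r) (hi r) μ₁ (gg r) h1M ((hlohi r).trans (hhi r)) (hhi r) h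
  rw [e]
  -- a shift of μ₁ by a point `k` that is self-sufficient for T₂ is DEC at T₁ + T₂
  have shift_ok : ∀ k, k ≤ M₂ → T₂ ≤ 2 * (k : ℝ) → DECAtT x (T₁ + T₂) j' (M₁ + M₂) (fun h => SH[μ₁, k, h]) := by
    intro k hk hk2
    have hsh := decAtT_shift_two x T₁ j₁ M₁ k μ₁ hμ₁
    exact decAtT_antitone_target (by linarith)
      (decAtT_mono_top (decAtT_layer_noGiant (by omega) (by omega : M₁ + k ≤ j') hsh) (by omega))
  rcases hval r hr with ⟨heq, hS⟩ | ⟨_, hgi, _⟩ | ⟨hlt, _, hcr⟩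
  · -- (S)-term: collapses to a shift
    have hS' : T₂ ≤ 2 * (lo r : ℝ) := by
      rcases hS with h2 | h2
      · exact h2
      · exfalso; have := (hlohi r).trans (hhi r); omega
    have e2 : (fun h => (1 - gg r) * SH[μ₁, lo r, h] + gg r * SH[μ₁, hi r, h]) = fun h => SH[μ₁, lo r, h] := by
      funext h; rw [heq]; ring
    rw [e2]
    exact shift_ok (lo r) ((hlohi r).trans (hhi r)) hS'
  · exfalso; have := hhi r; omega
  · -- a credit pair: the term is the shifted slice of μ₁ by the blob (hi − lo, g)
    obtain ⟨b, hb⟩ : ∃ b, hi r = lo r + b := ⟨hi r - lo r, by omega⟩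
    have hb1 : 1 ≤ b := by omega
    have hbr : ((hi r : ℝ) - lo r) = b := by rw [hb]; push_cast; ring
    rw [hbr] at hcr
    have hbM : lo r + b ≤ M₂ := by rw [← hb]; exact hhi r
    by_cases hxg : x ≤ gg r
    · -- heavy pair
      rw [if_pos hxg] at hcr
      have hsl := slice_heavy_decAtT_noGiant x T₁ (gg r) j₁ (M₁ + b) M₁ b μ₁ hx0 hx1 hxg (hgg r).2 hb1 hj₁ le_rfl hμ₁
      have hsh := decAtT_shift_two x _ (M₁ + b) (M₁ + b) (lo r) _ hsl
      have hfin := decAtT_antitone_target (show T₁ + T₂ ≤ T₁ + (b : ℝ) * gg r + 2 * (lo r : ℝ) by linarith)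
        (decAtT_mono_top (decAtT_layer_noGiant le_rfl (by omega : M₁ + b + lo r ≤ j') hsh) (by omega : M₁ + b + lo r ≤ M₁ + M₂))
      have e3 : (fun h => if lo r ≤ h then slice μ₁ b (gg r) (h - lo r) else 0)
          = fun h => (1 - gg r) * SH[μ₁, lo r, h] + gg r * SH[μ₁, hi r, h] := by
        funext h; rw [shift_slice, hb]
      rw [e3] at hfin
      exact hfin
    · push Not at hxg
      rw [if_neg (not_le.2 hxg)] at hcr
      by_cases hg2 : x ^ 2 < gg r
      · -- light pair with positive credit: SL-light, then shift
        have hsl := slice_light_decAtT_noGiant x T₁ (gg r) j₁ (M₁ + b) M₁ b μ₁ hx0 hx1 hg2 hxg hb1 hj₁ le_rfl hμ₁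
        have hsh := decAtT_shift_two x _ (M₁ + b) (M₁ + b) (lo r) _ hsl
        have hfin := decAtT_antitone_target
          (show T₁ + T₂ ≤ T₁ + (b : ℝ) * ((gg r - x ^ 2) / (1 - x)) + 2 * (lo r : ℝ) by linarith)
          (decAtT_mono_top (decAtT_layer_noGiant le_rfl (by omega : M₁ + b + lo r ≤ j') hsh) (by omega : M₁ + b + lo r ≤ M₁ + M₂))
        have e3 : (fun h => if lo r ≤ h then slice μ₁ b (gg r) (h - lo r) else 0)
            = fun h => (1 - gg r) * SH[μ₁, lo r, h] + gg r * SH[μ₁, hi r, h] := by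
          funext h; rw [shift_slice, hb]
        rw [e3] at hfin
        exact hfin
      · -- gate below x²: `lo` and `hi` self-sufficient for T₂; two shifts
        push Not at hg2
        have hκle : (gg r - x ^ 2) / (1 - x) ≤ 0 := div_nonpos_of_nonpos_of_nonneg (by linarith) (by linarith)
        have hlo2 : T₂ ≤ 2 * (lo r : ℝ) := by nlinarith [(Nat.cast_nonneg b : (0:ℝ) ≤ b)]
        have hhi2 : T₂ ≤ 2 * (hi r : ℝ) := by
          have : (lo r : ℝ) ≤ hi r := by exact_mod_cast hlt.le
          linarith
        have hm := decAtT_mixture (1 - gg r) (by linarith [(hgg r).2]) (by linarith [(hgg r).1])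
          (shift_ok (lo r) ((hlohi r).trans (hhi r)) hlo2) (shift_ok (hi r) (hhi r) hhi2)
        have e4 : (fun h => (1 - gg r) * SH[μ₁, lo r, h] + gg r * SH[μ₁, hi r, h])
            = fun h => (1 - gg r) * SH[μ₁, lo r, h] + (1 - (1 - gg r)) * SH[μ₁, hi r, h] := by
          funext h; ring
        rw [e4]; exact hm

end LawDec

end Quant

end Summit.CriticalPhenomena.PercolationContinuityZ3.Theorems
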